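import Literature.Barriers.SmoothPoincare4.GluckTwistsDissolve
import Literature.Topology.FourManifolds.ConnectedSumExistence
import Literature.Topology.FourManifolds.ConnectedSumSphereIdentity
import Literature.Topology.FourManifolds.GluckTwistMeridian
import Literature.Topology.FourManifolds.GluckTwistProofs
import Literature.Topology.FourManifolds.GluckDissolve
import Literature.Topology.FourManifolds.GluckTwistHomotopySphereProofs
import HarnessLib

/-!
# `GluckTwistCP2Barrier` from the dissolution theorem alone

Sibling of `Literature/Barriers/SmoothPoincare4/GluckTwistsDissolve.lean`. There the barrier
`Literature.Barriers.SmoothPoincare4.GluckTwistCP2Barrier.{u}` — every `ℂℙ²`-cancellative function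
`I` of connected closed smooth 4-manifolds (`IsCP2Cancellative I`) takes on every closed Gluck
twist `X` of `S⁴` the value `I S⁴` — is proved (`gluckTwistCP2Barrier_of_dissolve`) from FOUR
named facts entering as hypotheses (D-0014):

1. `gluckTwist_connectedSum_complexProjectivePlane` — the dissolution `Σ_K # ℂℙ² ≅ ℂℙ²`
   (Kasprowski–Powell–Ray 2023, Lemma 3.1; Akbulut–Yasui 2013, Cor. 1.3; Gompf–Stipsicz 1999,
   Ex. 5.2.7 (b); recorded for Gluck twists of `S⁴` in Manolescu–Marengon–Sarkar–Willis 2023,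
   proof of Cor. 6.15);
2. `Literature.Topology.FourManifolds.isConnectedSum_sphere_self` (`M = M # S⁴`, Kervaire–Milnor 1963, §2);
3. `Literature.Topology.FourManifolds.exists_isConnectedSum` (closed smooth connected sums exist, Kosinski VI.1);
4. `Literature.Topology.FourManifolds.nonempty_homotopyEquiv_sphere_of_isGluckTwist` (`Σ_K ≃ₕ S⁴`, Gluck 1962, §17),
   used only to know that `X` is connected.

Facts 2 and 3 are PROVED in the tree (`isConnectedSum_sphere_self_holds`,
`ConnectedSumSphereIdentity.lean`; `exists_isConnectedSum_holds`, `ConnectedSumExistence.lean`),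
and the connectedness of a Gluck twist follows from the tree's PROVED simple connectivity
(`simplyConnectedSpace_of_isGluckTwist_holds`, `GluckTwistMeridian.lean`, Gluck 1962, §17 via
Kervaire's meridian lemma and van Kampen) — the homotopy equivalence `Σ_K ≃ₕ S⁴` (Hurewicz and
Whitehead on top of `π₁ = 1`, `H₂ = H₃ = 0`) is not needed. Compactness of `X` is likewise a tree
theorem (`IsGluckTwist.compactSpace_holds`, `GluckTwistProofs.lean`), so it is dropped from the
hypotheses of the mechanism below.

Hence the barrier depends on exactly ONE undischarged input, the printed dissolution theorem:
`GluckTwistCP2Barrier.of_dissolve : gluckTwist_connectedSum_complexProjectivePlane → GluckTwistCP2Barrier`.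
That input is a genuine theorem of 4-dimensional handlebody theory (Akbulut–Yasui's proof: a
handle decomposition of `X ∖ ν(S)`, the dotted-circle/`0`-framing exchange realising the Gluck
twist as a plug twist, Lemma 2.2, handle slides over the odd-framed 2-handle supplied by
`ℂℙ¹ ⊂ ℂℙ²`, Lemma 3.1, and "every self-diffeomorphism of `∂D⁴` extends over `D⁴`"); it is NOT
discharged here and stays the named fact of the sibling file.

## MMSW 2023, Question 9.11 implies Cor. 1.13 for knots (appended; revised 2026-08-15)

The sibling file registers MMSW's open Question 9.11 for knots (`MMSW2023Question911Knot`: every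
knot slice in a homotopy 4-ball has `s = 0`) and the named fact
`rasmussen_eq_zero_of_isSliceDiscIn_gluckTwist` (Manolescu–Marengon–Sarkar–Willis 2023, Cor. 1.13 =
Cor. 6.15, knot case). A positive answer to the question implies the corollary
(`rasmussen_eq_zero_of_isSliceDiscIn_gluckTwist_of_question911`), because a Gluck twist is a compact
(`IsGluckTwist.compactSpace_holds`) homotopy 4-sphere (`nonempty_homotopyEquiv_sphere_of_isGluckTwist_holds`,
Gluck 1962, §17), as printed in §9.3 ("Recall from Corollary 1.13 that the
Freedman-Gompf-Morrison-Walker strategy ... cannot work for homotopy 4-spheres obtained from `S⁴`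
by Gluck twists. It remains an open question whether the strategy can work for other homotopy
4-spheres."). The closed Prop
`FGMWRasmussenStrategyGluck` of the sibling file (the strategy's Gluck case "some knot slice in a
punctured closed Gluck twist has `s ≠ 0`", REFUTED by Cor. 1.13: `not_fgmwRasmussenStrategyGluck`
there) is no longer mentioned here: the three bookkeeping lemmas about it that this file used to
carry (`not_fgmwRasmussenStrategyGluck_iff`, `fgmwRasmussenStrategyGluck_iff_not`,
`FGMWRasmussenStrategyGluck.fgmwRasmussenStrategy'`), referenced by nothing, were removed in the
2026-08-15 verdict clean-up so that the refuted Prop can be retired from the sibling file without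
breaking this importer.

## References

* C. Manolescu, M. Marengon, S. Sarkar, M. Willis, *A generalization of Rasmussen's invariant,
  with applications to surfaces in some four-manifolds*, Duke Math. J. 172 (2023), Cor. 1.13
  (= Cor. 6.15) and its proof, §9.3 [ManolescuMarengonSarkarWillis2023].
* D. Kasprowski, M. Powell, A. Ray, *Gluck twists on concordant or homotopic spheres*, Math. Res.
  Lett. 30 (2023), Lemma 3.1 [KasprowskiPowellRay2023].
* S. Akbulut, K. Yasui, *Gluck twisting 4-manifolds with odd intersection form*, Math. Res. Lett.
  20 (2013), Thm. 1.1, Cor. 1.3, Lemmas 2.2, 3.1 [AkbulutYasui2013].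
* H. Gluck, *The embedding of two-spheres in the four-sphere*, Trans. AMS 104 (1962), §17
  [GluckTAMS1962].
* M. Kervaire, J. Milnor, *Groups of homotopy spheres I*, Ann. of Math. 77 (1963), §2
  [KervaireMilnor1963].
* A. Kosinski, *Differential Manifolds* (1993), Ch. VI §1 [Kosinski1993].
-/

noncomputable section

open scoped Manifold ContDiff

namespace Literature.Barriers.SmoothPoincare4

universe u

open Literature.Topology.FourManifolds in
/-- **The mechanism, with the dissolution theorem as the only input.** If `I` is
`ℂℙ²`-cancellative (`IsCP2Cancellative I`) and Gluck twists dissolve after one `ℂℙ²` summand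
(`gluckTwist_connectedSum_complexProjectivePlane`: every smooth connected sum of a Gluck twist of
`S⁴` with `ℂℙ²` is diffeomorphic to `ℂℙ²`), then `I X = I S⁴` for every (Hausdorff, second
countable) smooth 4-manifold `X` which is a Gluck twist of `S⁴` along a 2-knot `K`. Proof: `X` is
compact (`IsGluckTwist.compactSpace_holds`) and simply connected
(`simplyConnectedSpace_of_isGluckTwist_holds`, Gluck 1962, §17), hence connected, as is `S⁴`
(`simplyConnectedSpace_sphere_four_holds`); a closed smooth connected sum `P` of `X` and `ℂℙ²`
exists (`exists_isConnectedSum_holds`, Kosinski VI.1), `P ≅ ℂℙ²` by dissolution, and `ℂℙ²` is a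
connected sum of `S⁴` and `ℂℙ²` (`isConnectedSum_sphere_self_holds`, Kervaire–Milnor 1963, §2,
"`Sⁿ` serves as identity element"), so cancellation gives `I X = I S⁴`.
[cite: KasprowskiPowellRay2023, Lemma 3.1] [cite: AkbulutYasui2013, Cor. 1.3]
[cite: ManolescuMarengonSarkarWillis2023, proof of Cor. 6.15 and §9.3] [cite: GluckTAMS1962, §17]
[cite: KervaireMilnor1963, §2] -/
theorem IsCP2Cancellative.apply_eq_of_isGluckTwist_of_dissolve {α : Type*}
    {I : ∀ (M : Type) [TopologicalSpace M] [ChartedSpace (EuclideanSpace ℝ (Fin 4)) M], α}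
    (hI : IsCP2Cancellative I)
    (hdis : gluckTwist_connectedSum_complexProjectivePlane)
    (K : TwoKnot) (X : Type) [TopologicalSpace X] [T2Space X] [SecondCountableTopology X]
    [ChartedSpace (EuclideanSpace ℝ (Fin 4)) X] [IsManifold (𝓡 4) ∞ X]
    (hX : IsGluckTwist (𝓡 4) X K) :
    I X = I (Metric.sphere (0 : EuclideanSpace ℝ (Fin 5)) 1) := by
  haveI : Nonempty X := hX.nonempty
  haveI : CompactSpace X := IsGluckTwist.compactSpace_holds hX
  haveI : SimplyConnectedSpace X := simplyConnectedSpace_of_isGluckTwist_holds hX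
  haveI : SimplyConnectedSpace (Metric.sphere (0 : EuclideanSpace ℝ (Fin 5)) 1) :=
    simplyConnectedSpace_sphere_four_holds
  obtain ⟨P, _, _, _, _, _, _, hP⟩ :=
    exists_isConnectedSum_holds (n := 4) X ComplexProjectivePlane
  obtain ⟨e⟩ := hdis K X hX P hP
  exact hI X (Metric.sphere (0 : EuclideanSpace ℝ (Fin 5)) 1) P ComplexProjectivePlane hP
    (isConnectedSum_sphere_self_holds (n := 4) ComplexProjectivePlane).symm ⟨e⟩

/-- **`GluckTwistCP2Barrier` from the dissolution theorem alone.** The barrier of the sibling file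
(no `ℂℙ²`-cancellative invariant distinguishes a closed Gluck twist of `S⁴` from `S⁴`) holds as
soon as the single named fact `gluckTwist_connectedSum_complexProjectivePlane` does
(`Σ_K # ℂℙ² ≅ ℂℙ²` for every 2-knot `K`; Kasprowski–Powell–Ray 2023, Lemma 3.1, Akbulut–Yasui
2013, Cor. 1.3, as used in Manolescu–Marengon–Sarkar–Willis 2023, proof of Cor. 6.15): the three
other hypotheses of `gluckTwistCP2Barrier_of_dissolve` are theorems of the tree (see
`IsCP2Cancellative.apply_eq_of_isGluckTwist_of_dissolve`). This is the exact trust base of the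
barrier: relative to Literature it is the one printed dissolution theorem.
[cite: KasprowskiPowellRay2023, Lemma 3.1] [cite: AkbulutYasui2013, Cor. 1.3]
[cite: ManolescuMarengonSarkarWillis2023, proof of Cor. 6.15 and §9.3] -/
theorem GluckTwistCP2Barrier.of_dissolve (hdis : gluckTwist_connectedSum_complexProjectivePlane) :
    GluckTwistCP2Barrier.{u} :=
  fun _ _ hI K X _ _ _ _ _ _ hX => hI.apply_eq_of_isGluckTwist_of_dissolve hdis K X hX

/-! ### The discharge -/

open Literature.Topology.FourManifolds in
/-- **The mechanism, discharged.** If `I` is `ℂℙ²`-cancellative then `I X = I S⁴` for every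
(Hausdorff, second countable) smooth 4-manifold `X` which is a Gluck twist of `S⁴` along a 2-knot
`K` — with NO further input: by the tree's dissolution theorem
`exists_isConnectedSum_complexProjectivePlane_of_isGluckTwist` (`GluckDissolve.lean`: the glued
manifold `M = (S⁴ ∖ ν(S² × D²)) ∪_τ Bl_p(S² × ℝ²)` is simultaneously a connected sum `X # ℂℙ²` —
glued by Gluck's `τ` — and, through the monomial involution of the toric blow-up model, a
connected sum `S⁴ # ℂℙ²`), there is one closed smooth `M` with `IsConnectedSum X ℂℙ² M` and
`IsConnectedSum S⁴ ℂℙ² M`, and cancellation (with `P = P' = M`, `φ = id`) gives `I X = I S⁴`;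
`X` and `S⁴` are connected as simply connected spaces (`simplyConnectedSpace_of_isGluckTwist_holds`,
`simplyConnectedSpace_sphere_four_holds`) and `X` is compact (`IsGluckTwist.compactSpace_holds`).
Gompf–Stipsicz (1999), Ex. 5.2.7(b); Akbulut–Yasui (2013), Cor. 1.3; as used in
Manolescu–Marengon–Sarkar–Willis (2023), proof of Cor. 6.15 and §9.3.
[cite: ManolescuMarengonSarkarWillis2023, proof of Cor. 6.15 and §9.3] [cite: AkbulutYasui2013, Cor. 1.3] -/
theorem IsCP2Cancellative.apply_eq_sphere_of_isGluckTwist {α : Type*}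
    {I : ∀ (M : Type) [TopologicalSpace M] [ChartedSpace (EuclideanSpace ℝ (Fin 4)) M], α}
    (hI : IsCP2Cancellative I)
    (K : TwoKnot) (X : Type) [TopologicalSpace X] [T2Space X] [SecondCountableTopology X]
    [ChartedSpace (EuclideanSpace ℝ (Fin 4)) X] [IsManifold (𝓡 4) ∞ X]
    (hX : IsGluckTwist (𝓡 4) X K) :
    I X = I (Metric.sphere (0 : EuclideanSpace ℝ (Fin 5)) 1) := by
  haveI : Nonempty X := hX.nonempty
  haveI : CompactSpace X := IsGluckTwist.compactSpace_holds hX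
  haveI : SimplyConnectedSpace X := simplyConnectedSpace_of_isGluckTwist_holds hX
  haveI : SimplyConnectedSpace (Metric.sphere (0 : EuclideanSpace ℝ (Fin 5)) 1) :=
    simplyConnectedSpace_sphere_four_holds
  obtain ⟨M, _, _, _, _, _, _, h₁, h₂⟩ :=
    exists_isConnectedSum_complexProjectivePlane_of_isGluckTwist K X hX
  exact hI X (Metric.sphere (0 : EuclideanSpace ℝ (Fin 5)) 1) M M h₁ h₂ ⟨Diffeomorph.refl (𝓡 4) M ∞⟩

/-- **`GluckTwistCP2Barrier` holds** (D-0014 discharge of the barrier of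
`Literature/Barriers/SmoothPoincare4/GluckTwistsDissolve.lean`): no `ℂℙ²`-cancellative function of
closed smooth 4-manifolds — in particular no invariant built from the Lee/Bar-Natan deformation of
Khovanov–Rozansky `𝔤𝔩₂`-homology as in Manolescu–Marengon–Sarkar–Willis (2023), Cor. 1.13 /
Cor. 6.15 — distinguishes a closed Gluck twist of `S⁴` from `S⁴`, because Gluck twists dissolve
after a single connected sum with `ℂℙ²`. The dissolution is proved in the tree
(`Literature.Topology.FourManifolds.exists_isConnectedSum_complexProjectivePlane_of_isGluckTwist`,
by the toric blow-up model of `Bl_p(S² × ℝ²)` and its monomial involution), so the barrier is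
now a theorem with no named-fact input.
[cite: ManolescuMarengonSarkarWillis2023, Cor. 1.13, proof of Cor. 6.15 and §9.3]
[cite: AkbulutYasui2013, Cor. 1.3] [cite: GluckTAMS1962, §17] -/
theorem GluckTwistCP2Barrier_holds : GluckTwistCP2Barrier.{u} :=
  fun _ _ hI K X _ _ _ _ _ _ hX => hI.apply_eq_sphere_of_isGluckTwist K X hX

/-! ### MMSW 2023, Question 9.11 (knots) implies Cor. 1.13 (knots) -/

open Literature.Topology.FourManifolds in
/-- **MMSW 2023, Cor. 1.13 (knot case) is a particular case of Question 9.11.** A positive answer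
to Manolescu–Marengon–Sarkar–Willis's open Question 9.11 for knots (`MMSW2023Question911Knot`:
every knot slice in a homotopy 4-ball has `s = 0`) implies the named fact
`rasmussen_eq_zero_of_isSliceDiscIn_gluckTwist` (the same for punctured Gluck twists of `S⁴`),
because a (Hausdorff, second countable) smooth Gluck twist `X` of `S⁴` is compact
(`IsGluckTwist.compactSpace_holds`) and a homotopy 4-sphere (Gluck 1962, §17, tree theorem
`nonempty_homotopyEquiv_sphere_of_isGluckTwist_holds`), so a slice disc in `X ∖ e(B̊⁴)` is a
homotopy-ball slice disc (`Knot.IsSliceDiscIn.isHomotopyBallSlice`). Printed: "Recall from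
Corollary 1.13 that the Freedman–Gompf–Morrison–Walker strategy ... cannot work for homotopy
4-spheres obtained from `S⁴` by Gluck twists. It remains an open question whether the strategy can
work for other homotopy 4-spheres" (§9.3, before Question 9.11).
[cite: ManolescuMarengonSarkarWillis2023, §9.3 and Question 9.11] [cite: GluckTAMS1962, §17] -/
theorem rasmussen_eq_zero_of_isSliceDiscIn_gluckTwist_of_question911
    (hQ : MMSW2023Question911Knot) : rasmussen_eq_zero_of_isSliceDiscIn_gluckTwist := by
  intro K₂ X _ _ _ _ _ hX K e f hK s hs
  haveI : CompactSpace X := IsGluckTwist.compactSpace_holds hX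
  exact hQ K (hK.isHomotopyBallSlice (nonempty_homotopyEquiv_sphere_of_isGluckTwist_holds hX)) s hs

end Literature.Barriers.SmoothPoincare4

end
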